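import Summits.Ventures.PercRepro.MSTightConjTGeneral
import Summits.Ventures.PercRepro.MSTightExcessOneComplex

/-!
# Theorem (YD) in full generality: a twin-free excess-one family with no minimum and no maximum
member has a simplicial complex of differences

Dossier proofs/MINE1-theoremS.md, Addendum 56 supplement 5. MSTightExcessOneComplex.lean assumed
`∅, univ ∉ F`, empty core and full support; with Theorem (T) in its general form
(`diffsY_subset_diffsX_of_no_min_max`) only «no minimum member» and «no maximum member» are
needed: an element in every member or in no member lies in no difference, so removing it is
trivial; any other element `a` is nontrivial, Theorem (SD) gives `{a} ∈ F \\ F`, and the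
tightening / non-tightening dichotomy of `erase_mem_diffs_of_genuine` goes through unchanged.
-/

namespace PercRepro.MSTight

open Finset
open scoped FinsetFamily

variable {α : Type*} [DecidableEq α] [Fintype α] {F : Finset (Finset α)}

/-- **`F \\ F` is closed under removing any element** for a twin-free excess-one family with no
minimum and no maximum member. -/
theorem erase_mem_diffs_of_no_min_max (htw : ∀ a b, Twin F a b → a = b)
    (hF : (F \\ F).card = F.card + 1) (hmin : ∀ t ∈ F, ∃ t' ∈ F, ¬ t ⊆ t')
    (hmax : ∀ t ∈ F, ∃ t' ∈ F, ¬ t' ⊆ t) (a : α) {d : Finset α} (hd : d ∈ F \\ F) :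
    d.erase a ∈ F \\ F := by
  by_cases had : a ∈ d
  · obtain ⟨A, hA, B, hB, hAB⟩ := mem_diffs.1 hd
    have hin : ∃ t ∈ F, a ∈ t := ⟨A, hA, (mem_sdiff.1 (hAB ▸ had)).1⟩
    have hout : ∃ t ∈ F, a ∉ t := ⟨B, hB, (mem_sdiff.1 (hAB ▸ had)).2⟩
    have hY : d.erase a ∈ diffsY a F :=
      mem_diffsY_iff.2 ⟨notMem_erase a d, by rwa [insert_erase had]⟩
    by_cases hP : Tight (proj a F)
    · exact (mem_diffsX_iff.1 (diffsY_subset_diffsX_of_no_min_max hF hmin hmax hP hY)).1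
    · have hε := card_inter_eq_card_partner_of_not_tight hF hP
      have hr : ({a} : Finset α) ∈ F \\ F :=
        singleton_mem_diffs_of_card_diffs_le hF.le (fun b hb => (htw a b hb).symm) hin hout
      have h0 : (∅ : Finset α) ∈ diffsX a F ∩ diffsY a F := by
        refine mem_inter.2 ⟨mem_diffsX_iff.2 ⟨?_, notMem_empty a⟩,
          mem_diffsY_iff.2 ⟨notMem_empty a, ?_⟩⟩
        · exact mem_diffs.2 ⟨A, hA, A, hA, Finset.sdiff_self A⟩
        · rw [insert_empty]
          exact hr
      have hK : (partner a F).Nonempty := by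
        rw [← card_pos, ← hε]
        exact card_pos.2 ⟨∅, h0⟩
      exact erase_mem_diffs_of_mem_diffs hε hK hd
  · rwa [erase_eq_of_notMem had]

/-- `F \\ F` is closed under removing any set of elements. -/
theorem sdiff_mem_diffs_of_no_min_max (htw : ∀ a b, Twin F a b → a = b)
    (hF : (F \\ F).card = F.card + 1) (hmin : ∀ t ∈ F, ∃ t' ∈ F, ¬ t ⊆ t')
    (hmax : ∀ t ∈ F, ∃ t' ∈ F, ¬ t' ⊆ t) (W : Finset α) {d : Finset α} (hd : d ∈ F \\ F) :
    d \ W ∈ F \\ F := by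
  induction W using Finset.induction_on with
  | empty => rwa [sdiff_empty]
  | insert a W _ ih =>
    rw [sdiff_insert]
    exact erase_mem_diffs_of_no_min_max htw hF hmin hmax a ih

/-- **THEOREM (YD), GENERAL FORM: the difference family of a twin-free excess-one family with no
minimum and no maximum member is a simplicial complex.** -/
theorem isDownSet_diffs_of_no_min_max (htw : ∀ a b, Twin F a b → a = b)
    (hF : (F \\ F).card = F.card + 1) (hmin : ∀ t ∈ F, ∃ t' ∈ F, ¬ t ⊆ t')
    (hmax : ∀ t ∈ F, ∃ t' ∈ F, ¬ t' ⊆ t) : IsDownSet (F \\ F) := by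
  intro d hd d' hd'
  have h := sdiff_mem_diffs_of_no_min_max htw hF hmin hmax (d \ d') hd
  rwa [Finset.sdiff_sdiff_eq_self hd'] at h

end PercRepro.MSTight
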